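import Literature.Computability.AlgebraicComplexity.LaserMethodValuesSym
import HarnessLib

/-!
# Tools for valuing the components of a product decomposition (Le Gall 2014, §5) — proved

Topic `Literature/Computability/AlgebraicComplexity`.  Le Gall, *Powers of tensors and fast matrix
multiplication* (ISSAC 2014, arXiv:1401.7714), §5 describes how the laser method is iterated on
`t ⊗ t'`: the product carries the decomposition whose labels are SUMS of labels ("the support is
`{(α₁(s)+α₁(s′), α₂(s)+α₂(s′), α₃(s)+α₃(s′))}`", p. 9), the component `(t ⊗ t′)(a,b,c)` is itself
decomposed by the PAIRS of labels ("the support is `{s ∈ supp(t) | (a−α₁(s), b−α₂(s), c−α₃(s)) ∈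
supp(t′)}` … the corresponding component is `t(s) ⊗ t′(a−α₁(s), …)`", p. 10), whose values are
bounded by supermultiplicativity, and matrix-tensor components are recognised directly.  This file
PROVES the general facts used to run that scheme in the tree's coordinates (`partSubtensor`,
`symm3`, `HasLaserValue`):

* Recognising matrix tensors: `tensorRestrictsTo_matMulTensor_mid` / `_left` / `_right` — a tensor
  with a family of entries `C x₀ (e_Y β) (e_Z β') = δ_{ββ'}` (resp. the two other pairings) restricts
  to `⟨1,m,1⟩` (resp. `⟨m,1,1⟩`, `⟨1,1,m⟩`).
* Pair labels: `partSubtensor_kronecker` (a pair-label component of `t ⊗ t'` is the Kronecker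
  product of components), `partSubtensor_partSubtensor_singleton` (a pair-label component of a
  sum-label component), `partSubtensor_rotate`, `rotate_kroneckerTensor`.
* Symmetrised values of products and rotations: `tensorRestrictsTo_symm3_kronecker` /
  `tensorRestrictsTo_kronecker_symm3` (`symm3 (A ⊗ B) ≷ symm3 A ⊗ symm3 B`),
  `HasLaserValue.symm3_kronecker` (`V(A ⊗ B) ≥ V(A) V(B)` in Le Gall's sense),
  `tensorRestrictsTo_symm3_rotate` and `HasLaserValue.symm3_rotate` (`V(t_C) ≥ V(t)`),
  `hasLaserValue_symm3_of_restrictsTo_matMulTensor`.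
* `maxEntropyPenalty_eq_zero_of_mul` — **`Γ_S(P) = 0` for a distribution of product form**
  `P(i,j,l) = f(i) g(j) h(l)` on `S` (Le Gall Prop. 4.1 / the tree's Lagrange certificate
  `maxEntropyPenalty_eq_of_lagrange` with `α_max = α`).

Everything is proved; no definitions; no named facts.

## References

* F. Le Gall, ISSAC 2014, arXiv:1401.7714 (held: `paper:arxiv-1401.7714`): §2.2, Prop. 4.1, §5
  (pp. 9–10). [LeGall2014]
* D. Coppersmith, S. Winograd, J. Symbolic Comput. 9 (1990), §8. [CoppersmithWinograd1990]
-/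

noncomputable section

open scoped BigOperators
open Finset

namespace Literature.Computability.AlgebraicComplexity

universe u

/-! ## Recognising matrix tensors from a family of entries -/

section Recognise

variable {K : Type u} [CommSemiring K]
variable {X Y Z : Type*} [Fintype X] [Fintype Y] [Fintype Z] [DecidableEq X] [DecidableEq Y]
  [DecidableEq Z]

/-- **`C ≥ ⟨1, m, 1⟩`** as soon as `C x₀ (e_Y β) (e_Z β') = δ_{ββ'}` for some `x₀` and index families
`e_Y, e_Z` (the tensor `∑_β x₀ y_β z_β` sits inside `C`). [folklore] -/
theorem tensorRestrictsTo_matMulTensor_mid (C : X → Y → Z → K) {m : ℕ} (x₀ : X) (eY : Fin m → Y)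
    (eZ : Fin m → Z) (h : ∀ β β', C x₀ (eY β) (eZ β') = if β = β' then 1 else 0) :
    TensorRestrictsTo C (matMulTensor K 1 m 1) := by
  have key : matMulTensor K 1 m 1 = fun a b c => C x₀ (eY b.2) (eZ c.1) := by
    funext a b c
    rw [h, matMulTensor]
    have h1 : a.1 = b.1 := Subsingleton.elim _ _
    have h2 : a.2 = c.2 := Subsingleton.elim _ _
    simp [h1, h2]
  rw [key]
  exact tensorRestrictsTo_precomp C (fun _ : Fin 1 × Fin 1 => x₀) (fun b : Fin 1 × Fin m => eY b.2)
    (fun c : Fin m × Fin 1 => eZ c.1)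

/-- **`C ≥ ⟨m, 1, 1⟩`** as soon as `C (e_X α) (e_Y α') z₀ = δ_{αα'}` (`∑_α x_α y_α z₀`). [folklore] -/
theorem tensorRestrictsTo_matMulTensor_left (C : X → Y → Z → K) {m : ℕ} (eX : Fin m → X)
    (eY : Fin m → Y) (z₀ : Z) (h : ∀ α α', C (eX α) (eY α') z₀ = if α = α' then 1 else 0) :
    TensorRestrictsTo C (matMulTensor K m 1 1) := by
  have key : matMulTensor K m 1 1 = fun a b c => C (eX a.1) (eY b.1) z₀ := by
    funext a b c
    rw [h, matMulTensor]
    have h1 : b.2 = c.1 := Subsingleton.elim _ _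
    have h2 : a.2 = c.2 := Subsingleton.elim _ _
    simp [h1, h2]
  rw [key]
  exact tensorRestrictsTo_precomp C (fun a : Fin m × Fin 1 => eX a.1) (fun b : Fin m × Fin 1 => eY b.1)
    (fun _ : Fin 1 × Fin 1 => z₀)

/-- **`C ≥ ⟨1, 1, m⟩`** as soon as `C (e_X γ) y₀ (e_Z γ') = δ_{γγ'}` (`∑_γ x_γ y₀ z_γ`). [folklore] -/
theorem tensorRestrictsTo_matMulTensor_right (C : X → Y → Z → K) {m : ℕ} (eX : Fin m → X) (y₀ : Y)
    (eZ : Fin m → Z) (h : ∀ γ γ', C (eX γ) y₀ (eZ γ') = if γ = γ' then 1 else 0) :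
    TensorRestrictsTo C (matMulTensor K 1 1 m) := by
  have key : matMulTensor K 1 1 m = fun a b c => C (eX a.2) y₀ (eZ c.2) := by
    funext a b c
    rw [h, matMulTensor]
    have h1 : a.1 = b.1 := Subsingleton.elim _ _
    have h2 : b.2 = c.1 := Subsingleton.elim _ _
    simp [h1, h2]
  rw [key]
  exact tensorRestrictsTo_precomp C (fun a : Fin 1 × Fin m => eX a.2) (fun _ : Fin 1 × Fin 1 => y₀)
    (fun c : Fin 1 × Fin m => eZ c.2)

end Recognise

/-! ## Pair labels, sum labels, rotations -/

section Labels

variable {K : Type u} [CommSemiring K]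
variable {X Y Z X' Y' Z' : Type*} {PX PY PZ PX' PY' PZ' : Type*} [DecidableEq PX] [DecidableEq PY]
  [DecidableEq PZ] [DecidableEq PX'] [DecidableEq PY'] [DecidableEq PZ']

/-- **A pair-label component of `t ⊗ t'` is the Kronecker product of the components**
(Le Gall §5: "the corresponding component is `t(s) ⊗ t′(s′)`"). [cite: LeGall2014, §5 (p. 10)] -/
theorem partSubtensor_kronecker (pX : X → PX) (pY : Y → PY) (pZ : Z → PZ) (pX' : X' → PX')
    (pY' : Y' → PY') (pZ' : Z' → PZ') (t : X → Y → Z → K) (t' : X' → Y' → Z' → K)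
    (i : PX) (j : PY) (l : PZ) (i' : PX') (j' : PY') (l' : PZ') :
    partSubtensor (fun x : X × X' => (pX x.1, pX' x.2)) (fun y : Y × Y' => (pY y.1, pY' y.2))
        (fun z : Z × Z' => (pZ z.1, pZ' z.2)) (kroneckerTensor t t') {(i, i')} {(j, j')} {(l, l')} =
      kroneckerTensor (partSubtensor pX pY pZ t {i} {j} {l})
        (partSubtensor pX' pY' pZ' t' {i'} {j'} {l'}) := by
  funext x y z
  simp only [partSubtensor_apply, Finset.mem_singleton, kroneckerTensor_apply, Prod.mk.injEq]
  by_cases h1 : pX x.1 = i ∧ pY y.1 = j ∧ pZ z.1 = l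
  · by_cases h2 : pX' x.2 = i' ∧ pY' y.2 = j' ∧ pZ' z.2 = l'
    · rw [if_pos h1, if_pos h2, if_pos ⟨⟨h1.1, h2.1⟩, ⟨h1.2.1, h2.2.1⟩, ⟨h1.2.2, h2.2.2⟩⟩]
    · rw [if_neg h2, if_neg (fun H => h2 ⟨H.1.2, H.2.1.2, H.2.2.2⟩), mul_zero]
  · rw [if_neg h1, if_neg (fun H => h1 ⟨H.1.1, H.2.1.1, H.2.2.1⟩), zero_mul]

/-- **A fine component of a coarse component.**  If the coarse labels factor through the fine ones
(`sX = φ ∘ pX`, …; e.g. sums of pairs), then the fine `(i,j,l)`-component of the coarse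
`(a,b,c)`-component of `T` is the fine `(i,j,l)`-component of `T` when `(φ i, φ' j, φ″ l) = (a,b,c)`
and `0` otherwise (Le Gall §5: the component `(t⊗t′)(a,b,c)` is decomposed by the pairs of labels
with prescribed sums). [cite: LeGall2014, §5 (p. 10)] -/
theorem partSubtensor_partSubtensor_singleton {SX SY SZ : Type*} [DecidableEq SX] [DecidableEq SY]
    [DecidableEq SZ] (pX : X → PX) (pY : Y → PY) (pZ : Z → PZ) (φX : PX → SX) (φY : PY → SY)
    (φZ : PZ → SZ) (T : X → Y → Z → K) (a : SX) (b : SY) (c : SZ) (i : PX) (j : PY) (l : PZ) :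
    partSubtensor pX pY pZ (partSubtensor (fun x => φX (pX x)) (fun y => φY (pY y))
        (fun z => φZ (pZ z)) T {a} {b} {c}) {i} {j} {l} =
      if φX i = a ∧ φY j = b ∧ φZ l = c then partSubtensor pX pY pZ T {i} {j} {l} else 0 := by
  by_cases hc : φX i = a ∧ φY j = b ∧ φZ l = c
  · rw [if_pos hc]
    funext x y z
    simp only [partSubtensor_apply, Finset.mem_singleton]
    by_cases h1 : pX x = i ∧ pY y = j ∧ pZ z = l
    · obtain ⟨rfl, rfl, rfl⟩ := h1
      simp [hc]
    · simp [h1]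
  · rw [if_neg hc]
    funext x y z
    simp only [partSubtensor_apply, Finset.mem_singleton, Pi.zero_apply]
    by_cases h1 : pX x = i ∧ pY y = j ∧ pZ z = l
    · obtain ⟨rfl, rfl, rfl⟩ := h1
      simp [hc]
    · simp [h1]

/-- Rotation commutes with Kronecker products (definitionally). [folklore] -/
theorem rotate_kroneckerTensor (A : X → Y → Z → K) (B : X' → Y' → Z' → K) :
    rotate (kroneckerTensor A B) = kroneckerTensor (rotate A) (rotate B) := rfl

/-- Components of a rotated tensor are the rotated components. [folklore] -/
theorem partSubtensor_rotate (pX : X → PX) (pY : Y → PY) (pZ : Z → PZ) (T : X → Y → Z → K)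
    (i : PX) (j : PY) (l : PZ) :
    partSubtensor pY pZ pX (rotate T) {j} {l} {i} = rotate (partSubtensor pX pY pZ T {i} {j} {l}) := by
  funext y z x
  simp only [partSubtensor_apply, rotate_apply, Finset.mem_singleton]
  by_cases h : pX x = i ∧ pY y = j ∧ pZ z = l
  · rw [if_pos h, if_pos ⟨h.2.1, h.2.2, h.1⟩]
  · rw [if_neg h, if_neg (fun H => h ⟨H.2.2, H.1, H.2.1⟩)]

end Labels

/-! ## Symmetrised values of products and rotations -/

section SymValues

variable {K : Type u} [Field K]
variable {ι κ μ ι' κ' μ' : Type*}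

/-- `symm3 A ⊗ symm3 B` is `symm3 (A ⊗ B)` read through the regrouping of the six factors. [folklore] -/
theorem kroneckerTensor_symm3_eq (A : ι → κ → μ → K) (B : ι' → κ' → μ' → K) :
    kroneckerTensor (symm3 A) (symm3 B) = fun a b c =>
      symm3 (kroneckerTensor A B)
        ((a.1.1, a.2.1), (a.1.2.1, a.2.2.1), (a.1.2.2, a.2.2.2))
        ((b.1.1, b.2.1), (b.1.2.1, b.2.2.1), (b.1.2.2, b.2.2.2))
        ((c.1.1, c.2.1), (c.1.2.1, c.2.2.1), (c.1.2.2, c.2.2.2)) := by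
  funext a b c
  simp only [kroneckerTensor_apply, rotate_apply]
  ring

/-- The regrouping equivalence `(ι×κ×μ) × (ι'×κ'×μ') ≃ (ι×ι') × (κ×κ') × (μ×μ')`. [folklore] -/
def regroup3 (ι κ μ ι' κ' μ' : Type*) :
    (ι × κ × μ) × (ι' × κ' × μ') ≃ (ι × ι') × (κ × κ') × (μ × μ') where
  toFun a := ((a.1.1, a.2.1), (a.1.2.1, a.2.2.1), (a.1.2.2, a.2.2.2))
  invFun b := ((b.1.1, b.2.1.1, b.2.2.1), (b.1.2, b.2.1.2, b.2.2.2))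
  left_inv := by rintro ⟨⟨a, b, c⟩, ⟨d, e, f⟩⟩; rfl
  right_inv := by rintro ⟨⟨a, b⟩, ⟨c, d⟩, ⟨e, f⟩⟩; rfl

variable [Fintype ι] [Fintype κ] [Fintype μ] [Fintype ι'] [Fintype κ'] [Fintype μ'] [DecidableEq ι]
  [DecidableEq κ] [DecidableEq μ] [DecidableEq ι'] [DecidableEq κ'] [DecidableEq μ']

/-- **`symm3 (A ⊗ B) ≥ symm3 A ⊗ symm3 B`** (relabelling). [cite: LeGall2014, §2.2 (supermultiplicativity)] -/
theorem tensorRestrictsTo_symm3_kronecker (A : ι → κ → μ → K) (B : ι' → κ' → μ' → K) :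
    TensorRestrictsTo (symm3 (kroneckerTensor A B)) (kroneckerTensor (symm3 A) (symm3 B)) := by
  rw [kroneckerTensor_symm3_eq]
  exact tensorRestrictsTo_precomp (symm3 (kroneckerTensor A B)) (regroup3 ι κ μ ι' κ' μ')
    (regroup3 κ μ ι κ' μ' ι') (regroup3 μ ι κ μ' ι' κ')

/-- **`symm3 A ⊗ symm3 B ≥ symm3 (A ⊗ B)`** (relabelling). [cite: LeGall2014, §2.2 (supermultiplicativity)] -/
theorem tensorRestrictsTo_kronecker_symm3 (A : ι → κ → μ → K) (B : ι' → κ' → μ' → K) :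
    TensorRestrictsTo (kroneckerTensor (symm3 A) (symm3 B)) (symm3 (kroneckerTensor A B)) := by
  rw [kroneckerTensor_symm3_eq]
  exact tensorRestrictsTo_of_reindex (symm3 (kroneckerTensor A B)) (regroup3 ι κ μ ι' κ' μ')
    (regroup3 κ μ ι κ' μ' ι') (regroup3 μ ι κ μ' ι' κ')

/-- **`V(A ⊗ B) ≥ V(A) · V(B)` in Le Gall's sense** ("the value is supermultiplicative").
[cite: LeGall2014, §2.2] -/
theorem HasLaserValue.symm3_kronecker {ρ : ℝ} {A : ι → κ → μ → K} {B : ι' → κ' → μ' → K}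
    {vA vB : ℝ} (hA : HasLaserValue ρ (symm3 A) vA) (hB : HasLaserValue ρ (symm3 B) vB)
    (hA0 : 0 ≤ vA) (hB0 : 0 ≤ vB) :
    HasLaserValue ρ (symm3 (kroneckerTensor A B)) (vA * vB) :=
  (hA.kronecker hB hA0 hB0).of_restrictsTo (tensorRestrictsTo_symm3_kronecker A B)

/-- `symm3 (rotate t) ≥ symm3 t` and conversely: the three factors are cyclically permuted
(`rotate³ = id`). [cite: LeGall2014, §2.2] -/
theorem tensorRestrictsTo_symm3_rotate (t : ι → κ → μ → K) :
    TensorRestrictsTo (symm3 (rotate t)) (symm3 t) := by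
  -- `symm3 (rotate t) = t_C ⊗ t_{C²} ⊗ t` and `symm3 t = t ⊗ t_C ⊗ t_{C²}`: move the last factor first
  have key : symm3 t = fun a b c =>
      symm3 (rotate t) (a.2.1, a.2.2, a.1) (b.2.1, b.2.2, b.1) (c.2.1, c.2.2, c.1) := by
    funext a b c
    simp only [kroneckerTensor_apply, rotate_apply]
    ring
  rw [key]
  exact tensorRestrictsTo_precomp _ _ _ _

/-- **`V(t_C) ≥ V(t)` in Le Gall's sense** (indeed equal). [cite: LeGall2014, §2.2] -/
theorem HasLaserValue.symm3_rotate {ρ : ℝ} {t : ι → κ → μ → K} {v : ℝ}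
    (h : HasLaserValue ρ (symm3 t) v) : HasLaserValue ρ (symm3 (rotate t)) v :=
  h.of_restrictsTo (tensorRestrictsTo_symm3_rotate t)

/-- **A component containing a matrix tensor has Le Gall-value `≥ (kmn)^{ρ/3}`.**
[cite: LeGall2014, §2.2] -/
theorem hasLaserValue_symm3_of_restrictsTo_matMulTensor (ρ : ℝ) {C : ι → κ → μ → K} {k m n : ℕ}
    (h : TensorRestrictsTo C (matMulTensor K k m n)) :
    HasLaserValue ρ (symm3 C) ((((k * m * n : ℕ) : ℝ) ^ (ρ / 3)) ^ 3) :=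
  (hasLaserValue_symm3_matMulTensor K ρ k m n).of_restrictsTo h.symm3

end SymValues

/-! ## Distributions of product form have no penalty -/

section Penalty

variable {ι κ μ : Type*} [Fintype ι] [Fintype κ] [Fintype μ]

/-- **`Γ_S(P) = 0` for a distribution of product form on `S`**: if `P ∈ D` is supported in `S` and
`P(i,j,l) = f(i) g(j) h(l) > 0` on `S`, then `max_{D(P)} H = H(P)` (the Lagrange certificate of
`maxEntropyPenalty_eq_of_lagrange` with `α_max = P`, `λ = log f, log g, log h`; Le Gall Prop. 4.1,
Conditions (i)–(ii), in the special case of a product). [cite: LeGall2014, Prop. 4.1] -/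
theorem maxEntropyPenalty_eq_zero_of_mul (S : Finset (ι × κ × μ)) {P : ι × κ × μ → ℝ}
    (hP : P ∈ stdSimplex ℝ (ι × κ × μ)) (hPS : ∀ x, x ∉ S → P x = 0)
    (f : ι → ℝ) (g : κ → ℝ) (h : μ → ℝ) (hf : ∀ x ∈ S, 0 < f x.1) (hg : ∀ x ∈ S, 0 < g x.2.1)
    (hh : ∀ x ∈ S, 0 < h x.2.2) (hprod : ∀ x ∈ S, P x = f x.1 * g x.2.1 * h x.2.2) :
    maxEntropyPenalty S P = 0 := by
  have hlag : ∀ x ∈ S, Real.exp (Real.log (f x.1) + Real.log (g x.2.1) + Real.log (h x.2.2) + 1 - 1) =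
      P x := by
    intro x hx
    rw [add_sub_cancel_right, Real.exp_add, Real.exp_add, Real.exp_log (hf x hx),
      Real.exp_log (hg x hx), Real.exp_log (hh x hx), hprod x hx]
  rw [maxEntropyPenalty_eq_of_lagrange (self_mem_sameMarginalsOn hP hPS)
    (lX := fun i => Real.log (f i)) (lY := fun j => Real.log (g j)) (lZ := fun l => Real.log (h l))
    (lS := 1) hlag, sub_self]

end Penalty

end Literature.Computability.AlgebraicComplexity
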